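import HarnessLib
import Summits.CriticalPhenomena.Ising3DConformalLimit.Theorems.HarmonicMomentsIsotropyTwoPointAsymptoticIsotropy
import Literature.Probability.LatticeModels.PointwiseScalingLimitScaleCovariant
import Summits.CriticalPhenomena.Ising3DConformalLimit.Theses.HarmonicMomentsIsotropy

/-!
# Vague asymptotic isotropy of the critical `ℤ³` two-point function, IX:
# a bare non-degenerate pointwise scaling limit suffices
(route HarmonicMomentsIsotropy, support item stmt-CriticalPhenomena-6036 `TwoPointAsymptoticIsotropy`)

The first conditional line (file VI, `twoPointAsymptoticIsotropy_of_existsScaleCovariantLimit`) derives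
the milestone from the shared existence crux `ExistsScaleCovariantLimit` (item stmt-CriticalPhenomena-1981):
a pointwise scaling limit `S` of `criticalCorr 3` (renormalisation `ρ > 0` on `(0,1]`) that is normalised
(`S = 0` off `NonCoincident`), non-degenerate, translation invariant and scale covariant with some
`Δ > 0`. This file records that four of these six clauses are free:

* `existsScaleCovariantLimit_of_pointwiseLimit` / `existsScaleCovariantLimit_iff_pointwiseLimit` — the
  crux `ExistsScaleCovariantLimit` is EQUIVALENT to the bare statement "there are `ρ > 0` on `(0,1]` and
  `S` with `HasPointwiseScalingLimit (criticalCorr 3) ρ S` and `IsNondegenerateTwoPoint S`": the normalised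
  family `S·𝟙_{NonCoincident}` is still a pointwise limit with the same `ρ` and is translation invariant
  (tree: `isTranslationInvariant_normalised_of_limit`, lattice translations), and scale covariance with
  SOME `Δ ∈ [1/2, 1]` is automatic for a non-degenerate full-filter limit (tree:
  `HasPointwiseScalingLimit.exists_rpow_scale_mem_Icc` — self-similarity of the lattice family,
  uniqueness of the limit up to scale, Messager–Miracle-Solé monotonicity, and the two-point window
  `c‖x‖⁻² ≤ ⟨σ₀σ_x⟩_{β_c} ≤ C‖x‖⁻¹`).
* `twoPointAsymptoticIsotropy_of_pointwiseLimit` — hence the milestone item 6036 follows from bare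
  existence of a non-degenerate pointwise scaling limit of the critical `ℤ³` correlators, with no
  covariance clause at all: isotropy AND scale covariance are outputs.

The unconditional milestone (and the existence statement) remain open on `ℤ³`
(Duminil-Copin, ICM 2022, §8.1 and §8.4). No definitions are introduced.

References: H. Duminil-Copin, *100 years of the (critical) Ising model on the hypercubic lattice*,
ICM 2022, §8.1, §8.4 [DuminilCopinICM2022]; P. Di Francesco, P. Mathieu, D. Sénéchal, *Conformal Field
Theory* (1997), §4.3.1 [FrancescoMathieuSenechal1997].
-/

noncomputable section

namespace Summit.CriticalPhenomena.Ising3DConformalLimit.HarmonicMomentsIsotropyTwoPoint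

open Literature.Probability.LatticeModels Filter Set
open scoped Topology
open Summit.CriticalPhenomena.Ising3DConformalLimit.Theses.HarmonicMomentsIsotropy
open Summit.CriticalPhenomena.Ising3DConformalLimit.MoebiusLimitExistsNegative
  (isTranslationInvariant_normalised_of_limit)

/-- **The existence crux needs no covariance clause.** If the critical `ℤ³` Ising correlators admit a
pointwise scaling limit `S` with renormalisation `ρ > 0` on `(0,1]` and non-degenerate two-point
function, then `ExistsScaleCovariantLimit` holds: the normalised family `S·𝟙_{NonCoincident}` is a
pointwise limit with the same `ρ`, vanishes off `NonCoincident`, is non-degenerate, translation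
invariant (`isTranslationInvariant_normalised_of_limit`) and scale covariant with the automatic
dimension `Δ ∈ [1/2, 1]` of `HasPointwiseScalingLimit.exists_rpow_scale_mem_Icc` (in particular
`Δ > 0`). [cite: DuminilCopinICM2022, §8.4] -/
theorem existsScaleCovariantLimit_of_pointwiseLimit {ρ : ℝ → ℝ} {S : CorrFamily 3}
    (hρ : ∀ δ ∈ Set.Ioc (0:ℝ) 1, 0 < ρ δ) (hlim : HasPointwiseScalingLimit (criticalCorr 3) ρ S)
    (hnd : IsNondegenerateTwoPoint S) : ExistsScaleCovariantLimit := by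
  classical
  obtain ⟨Δ, hΔ, hcov⟩ := hlim.exists_rpow_scale_mem_Icc hρ hnd
  -- the normalised family
  set S' : CorrFamily 3 := fun n z => if z ∈ NonCoincident 3 n then S n z else 0 with hS'
  have S'_in : ∀ {n : ℕ} {z : Fin n → EuclideanSpace ℝ (Fin 3)}, z ∈ NonCoincident 3 n →
      S' n z = S n z := fun hz => by simp only [hS', if_pos hz]
  have S'_out : ∀ {n : ℕ} {z : Fin n → EuclideanSpace ℝ (Fin 3)}, z ∉ NonCoincident 3 n →
      S' n z = 0 := fun hz => by simp only [hS', if_neg hz]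
  have hlim' : HasPointwiseScalingLimit (criticalCorr 3) ρ S' :=
    fun n => (hlim n).congr_right fun z hz => (S'_in hz).symm
  refine ⟨ρ, Δ, S', hρ, lt_of_lt_of_le one_half_pos hΔ.1, hlim', fun n z hz => S'_out hz,
    fun z hz => ?_, isTranslationInvariant_normalised_of_limit hlim, fun n c hc z => ?_⟩
  · rw [S'_in hz]
    exact hnd z hz
  · by_cases hz : z ∈ NonCoincident 3 n
    · rw [S'_in (smul_mem_nonCoincident hc.ne' hz), S'_in hz]
      exact hcov n c hc z hz
    · have hz' : (fun i => c • z i) ∉ NonCoincident 3 n := fun h =>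
        hz (((smul_right_injective (EuclideanSpace ℝ (Fin 3)) hc.ne').of_comp_iff z).1 h)
      rw [S'_out hz', S'_out hz, mul_zero]

/-- **Item stmt-CriticalPhenomena-1981 ⟺ bare existence.** `ExistsScaleCovariantLimit` holds iff the
critical `ℤ³` correlators admit a pointwise scaling limit (some `ρ > 0` on `(0,1]`) with non-degenerate
two-point function; the normalisation, translation-invariance, `Δ > 0` and scale-covariance clauses of
the crux carry no information. [cite: DuminilCopinICM2022, §8.4] -/
theorem existsScaleCovariantLimit_iff_pointwiseLimit :
    ExistsScaleCovariantLimit ↔ ∃ (ρ : ℝ → ℝ) (S : CorrFamily 3), (∀ δ ∈ Set.Ioc (0:ℝ) 1, 0 < ρ δ) ∧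
      HasPointwiseScalingLimit (criticalCorr 3) ρ S ∧ IsNondegenerateTwoPoint S :=
  ⟨fun ⟨ρ, _, S, hρ, _, hlim, _, hnd, _, _⟩ => ⟨ρ, S, hρ, hlim, hnd⟩,
    fun ⟨_, _, hρ, hlim, hnd⟩ => existsScaleCovariantLimit_of_pointwiseLimit hρ hlim hnd⟩

/-- **Bare existence of a non-degenerate pointwise scaling limit gives the milestone.** If the critical
`ℤ³` Ising correlators admit a pointwise scaling limit `S` (ANY renormalisation `ρ > 0` on `(0,1]`, no
covariance, normalisation or invariance clause) with non-degenerate two-point function, then the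
critical two-point function is asymptotically `O(3)`-invariant in the vague sense
(`TwoPointAsymptoticIsotropy`, item stmt-CriticalPhenomena-6036): `existsScaleCovariantLimit_of_pointwiseLimit`
followed by file VI (`twoPointAsymptoticIsotropy_of_existsScaleCovariantLimit`: nine-mirror RP rigidity of
the limit kernel and the lattice-to-continuum transfer). Both scale covariance and rotation invariance
are thus OUTPUTS of existence. [cite: DuminilCopinICM2022, §8.1] -/
theorem twoPointAsymptoticIsotropy_of_pointwiseLimit
    (h : ∃ (ρ : ℝ → ℝ) (S : CorrFamily 3), (∀ δ ∈ Set.Ioc (0:ℝ) 1, 0 < ρ δ) ∧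
      HasPointwiseScalingLimit (criticalCorr 3) ρ S ∧ IsNondegenerateTwoPoint S) :
    TwoPointAsymptoticIsotropy :=
  twoPointAsymptoticIsotropy_of_existsScaleCovariantLimit (existsScaleCovariantLimit_iff_pointwiseLimit.2 h)

end Summit.CriticalPhenomena.Ising3DConformalLimit.HarmonicMomentsIsotropyTwoPoint

end
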